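/-
Copyright: the b2b-balaban cell (near-miss cell 7), T⁴-continuum fan-out; row NE7b ROUND-2 swarm, seat
t4-ne7b-formalise-leaf-05 gen 2 (row S6g′ binding of `t4/b2b-balaban-t4-ne7b-p1/LEAVES-NE7b.md`, owner's ruling R-OWNER-22-12 (2)).
Released under the licence of the surrounding project.
-/
import Summits.QuantumFields.BalabanUV.T4Continuum.Support.HistoryJoinsClass
import Summits.QuantumFields.BalabanUV.T4Continuum.Support.HistoryZoneMassJoins
import Summits.QuantumFields.BalabanUV.T4Continuum.Support.ZoneExtentLaw

/-!
# History joins, part 6: the BUDGET — the product over the joins telescoped into four additive functionals (row S6g′)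

Summits-side support leaf of the T⁴-continuum cell (rung (B)+1 on a FINITE torus only; NOT infinite volume, NOT the
mass gap, NOT the Clay statement; NOT a proof of the spine estimate NE7b).  Row NE7b, route «COUNT»; row S6g′, the
binding, continued from `HistoryJoinsTotal` (part 4) and `HistoryJoinsClass` (part 5).  [folklore] well-founded
recursion and real arithmetic over the lineage's own carrier with the displayed zone data; nothing is quoted from
print, nothing printed is asserted, no `[cite:]` tag, no `Prop` fact of Bałaban's.

WHAT.  Four functionals of the shape tree, ADDITIVE ∕ MULTIPLICATIVE over its joins (defined along the top join like
`jW`): `mrg` (Σ_joins (r−1) = the number of non-host parts), `RK rank` (Σ_joins Σ_{i≠h} rank t (part i)), `MS M`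
(Σ_joins Σ_parts M t (part) — the joins' total zone masses), `NZP ext NZ` (∏_joins ∏_{i≠h} NZ_i).  **`jW_le_budget`**:
under the per-join rank-fibre display `JoinFib` at every join of `G`,
`jW G ≤ exp(2·mrg G + c·RK G + MS G ∕ (1−e^{−c})²) · NZP G` (part 5's `jfac_le_exp` telescoped); with part 4:
**`card_S_le_budget`**.  And the placement-rate book-keeping **`NZP_le_pow`**: if `NZ r t s ≤ Mρ r · Λ^{t+1−s}` then
`NZP G ≤ MρP G · Λ^{partnerAges st G}` (the tournament identity `HistoryJoins.partnerAges_add_eq_sum_clusterParts` join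
by join), so the count reads `≤ exp(2·mrg + c·RK + MS∕(1−e^{−c})²) · MρP · Λ^{partnerAges}` — `mrg ≤ #merges`,
`RK ≤ partnerAges + Σ fat` (leaf-10's rank), `MS ≤` row (a)'s class-linear total, `log MρP ≤` const·#parts + d·Σ ext:
the consumer's class-linear conversion to `exp(θm·F_w)·Λm^{partnerAges}`.

HONEST SCOPE.  Displayed: zone data and laws (parts 2–3), rank and rank fibres per join (part 5).  NE7b NOT proved.
HONEST DEPENDENCY (cell): continuum YM on T⁴ ⇐ BetaPertH ∧ nine spine estimates (0/9 proved); BetaPertH ⇐ (D1) ∧ (D4)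
∧ CAP+tail.  This file changes none of it.
-/

open Finset
open Literature.MathematicalPhysics.QuantumFieldTheory.Balaban1983to89
open T4PersistenceDictionary T4PartnerMultiplicity T4BranchingRecordsGas
open Summit.QuantumFields.BalabanUV.T4Continuum.HistoryJoins
open Summit.QuantumFields.BalabanUV.T4Continuum.HistoryJoinsAdm
open Summit.QuantumFields.BalabanUV.T4Continuum.HistoryJoinsCount
open Summit.QuantumFields.BalabanUV.T4Continuum.HistoryJoinsTotal
open Summit.QuantumFields.BalabanUV.T4Continuum.HistoryJoinsClass
open Summit.QuantumFields.BalabanUV.T4Continuum.ZoneTorus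

namespace Summit.QuantumFields.BalabanUV.T4Continuum.HistoryJoinsBudget

noncomputable section

open scoped Classical

variable {ε : Type*} (st : ε → ℕ) (M : ℕ → Gen ε → ℕ) (ext : ℕ → Gen ε → ℝ) (NZ : ℝ → ℕ → ℕ → ℕ)
  (rank : ℕ → Gen ε → ℕ) (Mρ : ℝ → ℝ)

/-! ## §1 The four functionals -/

/-- the number of non-host parts over all joins (`Σ_joins (r − 1)`) [folklore] -/
def mrg : Gen ε → ℝ
  | Gen.born _ _ => 0
  | Gen.renew G _ _ => mrg G
  | Gen.merge X Y e => ((npart st (Gen.merge X Y e) : ℝ) - 1) + ∑ i : Fin (npart st (Gen.merge X Y e)), mrg (part st _ i).2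
termination_by G => gsize G
decreasing_by
  · simp [gsize]
  · exact gsize_lt_of_mem_jparts st _ _ (part_mem st _ i)

/-- the ranks of the non-host parts over all joins [folklore] -/
def RK : Gen ε → ℝ
  | Gen.born _ _ => 0
  | Gen.renew G _ _ => RK G
  | Gen.merge X Y e =>
      (∑ i ∈ univ.filter (fun i => i ≠ hostIdx st X Y e), (rank (st e) (part st (Gen.merge X Y e) i).2 : ℝ)) +
        ∑ i : Fin (npart st (Gen.merge X Y e)), RK (part st _ i).2
termination_by G => gsize G
decreasing_by
  · simp [gsize]
  · exact gsize_lt_of_mem_jparts st _ _ (part_mem st _ i)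

/-- the joins' total zone masses [folklore] -/
def MS : Gen ε → ℝ
  | Gen.born _ _ => 0
  | Gen.renew G _ _ => MS G
  | Gen.merge X Y e => (∑ j, (M (st e) (part st (Gen.merge X Y e) j).2 : ℝ)) +
      ∑ i : Fin (npart st (Gen.merge X Y e)), MS (part st _ i).2
termination_by G => gsize G
decreasing_by
  · simp [gsize]
  · exact gsize_lt_of_mem_jparts st _ _ (part_mem st _ i)

/-- the product of the one-block root counts over all joins [folklore] -/
def NZP : Gen ε → ℝ
  | Gen.born _ _ => 1
  | Gen.renew G _ _ => NZP G
  | Gen.merge X Y e =>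
      (∏ i : {i // i ≠ hostIdx st X Y e},
        (NZ (ext (st e) (part st (Gen.merge X Y e) i.1).2) (st e) (part st _ i.1).2.rootStep : ℝ)) *
        ∏ i : Fin (npart st (Gen.merge X Y e)), NZP (part st _ i).2
termination_by G => gsize G
decreasing_by
  · simp [gsize]
  · exact gsize_lt_of_mem_jparts st _ _ (part_mem st _ i)

/-- the product of the radius factors over all joins [folklore] -/
def MρP : Gen ε → ℝ
  | Gen.born _ _ => 1
  | Gen.renew G _ _ => MρP G
  | Gen.merge X Y e => (∏ i : {i // i ≠ hostIdx st X Y e}, Mρ (ext (st e) (part st (Gen.merge X Y e) i.1).2)) *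
      ∏ i : Fin (npart st (Gen.merge X Y e)), MρP (part st _ i).2
termination_by G => gsize G
decreasing_by
  · simp [gsize]
  · exact gsize_lt_of_mem_jparts st _ _ (part_mem st _ i)

/-- `NZP ≥ 0` [folklore] -/
theorem NZP_nonneg : ∀ G : Gen ε, 0 ≤ NZP st ext NZ G
  | Gen.born _ _ => by rw [NZP]; exact zero_le_one
  | Gen.renew G _ _ => by rw [NZP]; exact NZP_nonneg G
  | Gen.merge X Y e => by
      rw [NZP]
      exact mul_nonneg (prod_nonneg fun _ _ => Nat.cast_nonneg _) (prod_nonneg fun i _ => NZP_nonneg _)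
termination_by G => gsize G
decreasing_by
  · simp [gsize]
  · exact gsize_lt_of_mem_jparts st _ _ (part_mem st _ i)

/-- `MρP ≥ 0` for `Mρ ≥ 0` [folklore] -/
theorem MρP_nonneg (hMρ : ∀ r, 0 ≤ Mρ r) : ∀ G : Gen ε, 0 ≤ MρP st ext Mρ G
  | Gen.born _ _ => by rw [MρP]; exact zero_le_one
  | Gen.renew G _ _ => by rw [MρP]; exact MρP_nonneg hMρ G
  | Gen.merge X Y e => by
      rw [MρP]
      exact mul_nonneg (prod_nonneg fun _ _ => hMρ _) (prod_nonneg fun i _ => MρP_nonneg hMρ _)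
termination_by G => gsize G
decreasing_by
  · simp [gsize]
  · exact gsize_lt_of_mem_jparts st _ _ (part_mem st _ i)

/-- **THE BUDGET**. [folklore] -/
def budget (c : ℝ) (G : Gen ε) : ℝ :=
  Real.exp (2 * mrg st G + c * RK st rank G + MS st M G / (1 - Real.exp (-c)) ^ 2) * NZP st ext NZ G

/-! ## §2 The per-join rank-fibre display and the telescoped bound -/

/-- the rank-fibre display AT a node: for a merger, «at most `ρ + 1` non-empty classes of rank `ρ`» in its top join;
vacuous elsewhere. [folklore] -/
def JoinFib : Gen ε → Prop
  | Gen.merge X Y e => ∀ ρ : ℕ,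
      ((univ.filter fun j : Fin (npart st (Gen.merge X Y e)) => 1 ≤ csize st X Y e j).filter
        fun j => rank (st e) (part st _ j).2 = ρ).card ≤ ρ + 1
  | _ => True

/-- **`jW ≤ budget`** when the rank-fibre display holds at every join of `G`. [folklore] -/
theorem jW_le_budget {c : ℝ} (hc : 0 < c) :
    ∀ G : Gen ε, (∀ q ∈ croots st G, JoinFib st rank q.2) → jW st M ext NZ G ≤ budget st M ext NZ rank c G
  | Gen.born b j, _ => by
      simp [budget, jW_born, mrg, RK, MS, NZP]
  | Gen.renew G e h, hfib => by
      rw [jW_renew, budget, mrg, RK, MS, NZP]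
      exact jW_le_budget hc G (by simpa using hfib)
  | Gen.merge X Y e, hfib => by
      -- the display at the top join and at the parts' joins
      have htop : JoinFib st rank (Gen.merge X Y e) :=
        hfib _ ((mem_croots_merge_iff st X Y e _).2 (Or.inl rfl))
      have hparts : ∀ i : Fin (npart st (Gen.merge X Y e)), ∀ q ∈ croots st (part st _ i).2, JoinFib st rank q.2 :=
        fun i q hq => hfib ((part st (Gen.merge X Y e) i).1 ++ q.1, q.2) ((mem_croots_merge_iff st X Y e _).2
          (Or.inr ⟨part st _ i, part_mem st _ i, q, hq, rfl⟩))
      have ih : ∀ i : Fin (npart st (Gen.merge X Y e)),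
          jW st M ext NZ (part st _ i).2 ≤ budget st M ext NZ rank c (part st _ i).2 :=
        fun i => jW_le_budget hc (part st _ i).2 (hparts i)
      have hj := jfac_le_exp (st := st) (X := X) (Y := Y) (e := e) M ext NZ rank hc htop
      rw [jW_merge, budget, mrg, RK, MS, NZP]
      -- `jW = jfac · ∏ jW_i ≤ (exp(top) · ∏ NZ_i) · ∏ budget_i`
      have h1 : jfac st M ext NZ X Y e * ∏ i, jW st M ext NZ (part st (Gen.merge X Y e) i).2 ≤
          (Real.exp (2 * ((npart st (Gen.merge X Y e) : ℝ) - 1) +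
              c * ∑ i ∈ univ.filter (fun i => i ≠ hostIdx st X Y e), (rank (st e) (part st (Gen.merge X Y e) i).2 : ℝ) +
              (∑ j, (M (st e) (part st (Gen.merge X Y e) j).2 : ℝ)) / (1 - Real.exp (-c)) ^ 2) *
            ∏ i : {i // i ≠ hostIdx st X Y e},
              (NZ (ext (st e) (part st (Gen.merge X Y e) i.1).2) (st e) (part st _ i.1).2.rootStep : ℝ)) *
          ∏ i, budget st M ext NZ rank c (part st (Gen.merge X Y e) i).2 :=
        mul_le_mul hj (prod_le_prod (fun i _ => jW_nonneg st M ext NZ _) fun i _ => ih i)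
          (prod_nonneg fun i _ => jW_nonneg st M ext NZ _)
          (mul_nonneg (Real.exp_pos _).le (prod_nonneg fun _ _ => Nat.cast_nonneg _))
      refine h1.trans (le_of_eq ?_)
      -- regroup: exponentials add, products multiply
      simp only [budget]
      rw [prod_mul_distrib, ← Real.exp_sum, sum_add_distrib, sum_add_distrib, ← mul_sum, ← mul_sum, ← sum_div,
        mul_mul_mul_comm, ← Real.exp_add]
      congr 1
      congr 1
      ring
termination_by G => gsize G
decreasing_by
  · simp [gsize]
  · exact gsize_lt_of_mem_jparts st _ _ (part_mem st _ i)

/-- **THE COUNT AGAINST THE BUDGET**: `#S G z ≤ exp(2·mrg + c·RK + MS∕(1−e^{−c})²)·NZP` under the displayed laws of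
parts 3 and 5. [folklore] -/
theorem card_S_le_budget {γ β R : Type*} [DecidableEq β] [LinearOrder R] [Fintype γ] {D : ℕ}
    (zone : ℕ → Gen ε → (Addr D → γ) → Finset β) (ρ : (Addr D → γ) → R) (c₀ : γ)
    (near : β → ℕ → γ → ℕ → ℝ → Prop)
    (hcard : ∀ (t : ℕ) (Z : Gen ε) (p : Addr D → γ), p ∈ Sany zone ρ c₀ st Z → (zone t Z p).card ≤ M t Z)
    (hloc : ∀ (t : ℕ) (Z : Gen ε) (p : Addr D → γ) (u : β), p ∈ Sany zone ρ c₀ st Z → u ∈ zone t Z p →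
      near u t (evalA c₀ p (rootAddr Z)) Z.rootStep (ext t Z))
    (hNZ : ∀ (u : β) (t s : ℕ) (r : ℝ), (univ.filter fun y : γ => near u t y s r).card ≤ NZ r t s)
    {c : ℝ} (hc : 0 < c) (G : Gen ε) (hfib : ∀ q ∈ croots st G, JoinFib st rank q.2) (z : γ) :
    ((S zone ρ c₀ st G z).card : ℝ) ≤ budget st M ext NZ rank c G :=
  (card_S_le_jW zone ρ c₀ st M ext NZ near hcard hloc hNZ G z).trans (jW_le_budget st M ext NZ rank hc G hfib)

/-! ## §3 The placement rate: `NZP ≤ MρP · Λ^{partnerAges}` (tournament identity) -/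

/-- a list sum as a sum over its indices [folklore] -/
private theorem sum_map_eq_sum_get {α N : Type*} [AddCommMonoid N] (l : List α) (g : α → N) :
    (l.map g).sum = ∑ i : Fin l.length, g (l.get i) := by
  induction l with
  | nil => simp
  | cons a l ih =>
      rw [List.map_cons, List.sum_cons, ih]
      show g a + ∑ i : Fin l.length, g (l.get i) = ∑ i : Fin (l.length + 1), g ((a :: l).get i)
      rw [Fin.sum_univ_succ]
      rfl

/-- splitting the host off a sum over the parts [folklore] -/
theorem sum_eq_host_add {n : ℕ} (h : Fin n) (f : Fin n → ℕ) : ∑ i, f i = f h + ∑ i : {i // i ≠ h}, f i.1 := by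
  rw [← Finset.add_sum_erase univ f (mem_univ h)]
  congr 1
  exact Finset.sum_subtype (univ.erase h) (p := fun i => i ≠ h) (fun i => by simp) f

/-- **THE PARTNER AGES OF A MERGER ARE ITS PARTS' PLUS THE NON-HOST PARTS' ROOT AGES AT THE JOIN STEP**
(`HistoryJoins.partnerAges_add_eq_sum_clusterParts` with the host cancelled). [folklore] -/
theorem partnerAges_merge_eq (X Y : Gen ε) (e : ε) :
    partnerAges st (Gen.merge X Y e) =
      ∑ i : Fin (npart st (Gen.merge X Y e)), partnerAges st (part st _ i).2 +
        ∑ i : {i // i ≠ hostIdx st X Y e}, (st e + 1 - (part st (Gen.merge X Y e) i.1).2.rootStep) := by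
  have H := partnerAges_add_eq_sum_clusterParts st (st e) (Gen.merge X Y e)
  rw [sum_map_eq_sum_get] at H
  change partnerAges st (Gen.merge X Y e) + (st e + 1 - (Gen.merge X Y e).rootStep) =
    ∑ i : Fin (npart st (Gen.merge X Y e)),
      (partnerAges st (part st _ i).2 + (st e + 1 - (part st (Gen.merge X Y e) i).2.rootStep)) at H
  rw [sum_add_distrib, sum_eq_host_add (hostIdx st X Y e) (fun i => st e + 1 - (part st (Gen.merge X Y e) i).2.rootStep),
    ← rootStep_eq_host] at H
  omega

/-- **`NZP ≤ MρP · Λ^{partnerAges}`** when the one-block root count carries the blocking fibre of the free root,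
`NZ r t s ≤ Mρ r · Λ^{t+1−s}` (row (b): `(2r+1)^d·(L^d)^{t+1−s}`). [folklore] -/
theorem NZP_le_pow {Λ : ℝ} (hΛ : 0 ≤ Λ) (hMρ : ∀ r, 0 ≤ Mρ r)
    (hNZle : ∀ (r : ℝ) (t s : ℕ), (NZ r t s : ℝ) ≤ Mρ r * Λ ^ (t + 1 - s)) :
    ∀ G : Gen ε, NZP st ext NZ G ≤ MρP st ext Mρ G * Λ ^ partnerAges st G
  | Gen.born b j => by simp [NZP, MρP]
  | Gen.renew G e h => by
      rw [NZP, MρP, partnerAges_renew]; exact NZP_le_pow hΛ hMρ hNZle G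
  | Gen.merge X Y e => by
      have ih : ∀ i : Fin (npart st (Gen.merge X Y e)),
          NZP st ext NZ (part st _ i).2 ≤ MρP st ext Mρ (part st _ i).2 * Λ ^ partnerAges st (part st _ i).2 :=
        fun i => NZP_le_pow hΛ hMρ hNZle (part st _ i).2
      have hMρP0 : ∀ Z : Gen ε, 0 ≤ MρP st ext Mρ Z := MρP_nonneg st ext Mρ hMρ
      rw [NZP, MρP, partnerAges_merge_eq st X Y e, pow_add, ← prod_pow_eq_pow_sum, ← prod_pow_eq_pow_sum]
      calc (∏ i : {i // i ≠ hostIdx st X Y e},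
              (NZ (ext (st e) (part st (Gen.merge X Y e) i.1).2) (st e) (part st _ i.1).2.rootStep : ℝ)) *
            ∏ i, NZP st ext NZ (part st (Gen.merge X Y e) i).2
          ≤ (∏ i : {i // i ≠ hostIdx st X Y e}, Mρ (ext (st e) (part st (Gen.merge X Y e) i.1).2) *
                Λ ^ (st e + 1 - (part st (Gen.merge X Y e) i.1).2.rootStep)) *
              ∏ i, MρP st ext Mρ (part st (Gen.merge X Y e) i).2 * Λ ^ partnerAges st (part st _ i).2 :=
            mul_le_mul (prod_le_prod (fun _ _ => Nat.cast_nonneg _) fun i _ => hNZle _ _ _)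
              (prod_le_prod (fun i _ => NZP_nonneg st ext NZ _) fun i _ => ih i)
              (prod_nonneg fun i _ => NZP_nonneg st ext NZ _)
              (prod_nonneg fun i _ => mul_nonneg (hMρ _) (pow_nonneg hΛ _))
        _ = _ := by rw [prod_mul_distrib, prod_mul_distrib]; ring
termination_by G => gsize G
decreasing_by
  · simp [gsize]
  · exact gsize_lt_of_mem_jparts st _ _ (part_mem st _ i)

/-! ## §4 Junction with row (a)-TOTAL: `MS` is the sum over `joins` of the parts' masses at the join step -/

/-- **`MS` IN THE CURRENCY OF `HistoryZoneMassJoins`**: the joins' total zone masses are the sum over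
`joins st G` (leaf-02 gen 3's path-free view of `croots`) of the sum over `tparts` of `M (ftime X) P` — so
`HistoryZoneMassTotal.sum_joins_tparts_zmass_add_le` bounds `MS` class-linearly once `M t P := zmass … t P + γ`.
[folklore] -/
theorem MS_eq_sum_joins :
    ∀ G : Gen ε, MS st M G =
      ((HistoryZoneMassJoins.joins st G).map fun X =>
        ((HistoryZoneMassJoins.tparts st X).map fun P => (M (ftime st X) P : ℝ)).sum).sum
  | Gen.born b j => by simp [MS, HistoryZoneMassJoins.joins, croots, crootsP]
  | Gen.renew G e h => by
      rw [MS, MS_eq_sum_joins G]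
      simp [HistoryZoneMassJoins.joins, croots, crootsP]
  | Gen.merge X Y e => by
      rw [MS, HistoryZoneMassJoins.sum_joins_merge, ← HistoryZoneMassJoins.sum_jparts_eq_sum_tparts,
        ← HistoryZoneMassJoins.sum_jparts_eq_sum_tparts, sum_map_eq_sum_get, sum_map_eq_sum_get]
      simp only [ftime]
      congr 1
      exact Finset.sum_congr rfl fun i _ => MS_eq_sum_joins (part st _ i).2
termination_by G => gsize G
decreasing_by
  · simp [gsize]
  · exact gsize_lt_of_mem_jparts st _ _ (part_mem st _ i)

end

end Summit.QuantumFields.BalabanUV.T4Continuum.HistoryJoinsBudget
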